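import Summits.ResolutionOfSingularities.ResolutionOfSingularities.Theorems.FrobeniusLadderFRationalResolutionMonoidAlgebraModel
import Summits.ResolutionOfSingularities.ResolutionOfSingularities.Theorems.FrobeniusLadderFRationalResolutionReductionOfPowers
import HarnessLib

/-!
# Crux `FrobeniusLadder.FRationalResolution` (stmt-ResolutionOfSingularities-15317), line `redirect`,
# stub `stub_diagonalizableQuotientResolution` — THE REDUCTION SLOT OF THE MONOID-ALGEBRA CERTIFICATE FROM EXPONENT ARITHMETIC:
# `k • g = v + q₁ + … + q_{k-1}` in `P` gives `(χᵍ)^k ∈ (χᵛ) · 𝔳_P^{k-1}`, hence `𝔳_P^{N(k-1)+1} ⊆ (χᵛ : v ∈ V) 𝔳_P^{N(k-1)}`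

`…MonoidAlgebraModel.hasResolution_of_isolated_fixedPoints_of_monoidAlgebra_certificate` (p843485) asks for a reduction `y` of the
centre (`J^{N+1} ⊆ (y) J^N`, `J = 𝔳_P^{b+1}`); `…ReductionOfPowers.pow_le_mul_pow_of_forall_pow_mem` (p843413) reduces this to one
factorization `xᵢ^k ∈ (y) J^{k-1}` per generator. In the monoid algebra `κ[P]` with `J = 𝔳_P = (χᵍ : g ∈ G)` (p843511) such a
factorization is EXPONENT ARITHMETIC: `k • g = v + q₁ + … + q_j` with `v ∈ V` (the chosen vertices), `0 ≠ q_i ∈ P`, `j + 1 ≤ k`.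

* ★ `single_pow_mem_mul_pow_of_nsmul_eq` — `(j+1) • g = v + Σ qᵢ` (`qᵢ ≠ 0`), `χᵛ ∈ K` ⇒ `(χᵍ)^k ∈ K · 𝔳_P^{k-1}` for every `k ≥ j+1`;
* ★★ `vertexIdeal_pow_le_of_nsmul_eq` — for `Fin`-indexed monomial generators `xv i = χ^{gᵢ}` of `𝔳_P` with such identities for every
  `i` (uniform bound `k`): `𝔳_P^{N(k-1)+1} ⊆ K · 𝔳_P^{N(k-1)}` — the slot `hred` (with `K = (y)`).

Honest label: elementary plumbing toward ONE leaf stub (no stub, crux or summit closed). No definitions, no named facts, no sorry.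
[folklore; cite: CoxLittleSchenck2011, §1.1; HunekeSwanson2006, Def. 1.2.1]
-/

noncomputable section

-- single-problem summit: the doubled namespace component is forced
set_option linter.dupNamespace false

namespace Summit.ResolutionOfSingularities.ResolutionOfSingularities.Theorems.FRationalResolution.MonoidAlgebraModel

variable (κ : Type) [Field κ] {n : ℕ} (P : AddSubmonoid (Fin n →₀ ℕ))

/-- The vertex ideal `𝔳_P = (χᵖ : 0 ≠ p ∈ P)` of the monoid algebra `κ[P]`. -/
local notation3 (prettyPrint := false) "𝕍[" κ ", " P "]" =>
  Ideal.span ((fun p : ↥P => AddMonoidAlgebra.single p (1 : κ)) '' {p : ↥P | p ≠ 0})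

/-- A product of `j` monomials `χ^{qᵢ}` with `qᵢ ≠ 0` lies in `𝔳_P^j`. [folklore] -/
theorem prod_single_mem_vertexIdeal_pow {j : ℕ} (q : Fin j → ↥P) (hq : ∀ i, q i ≠ 0) :
    ∏ i, AddMonoidAlgebra.single (q i) (1 : κ) ∈ 𝕍[κ, P] ^ j := by
  have h : ∏ i : Fin j, AddMonoidAlgebra.single (q i) (1 : κ) ∈ ∏ _i : Fin j, 𝕍[κ, P] :=
    Ideal.prod_mem_prod fun i _ => single_mem_vertexIdeal κ P (q i) (hq i)
  rwa [Finset.prod_const, Finset.card_univ, Fintype.card_fin] at h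

/-- ★ **A factorization of a power of a monomial from exponent arithmetic.** If `(j+1) • g = v + q₁ + … + q_j` in `P` with all
`qᵢ ≠ 0` and `χᵛ ∈ K`, then `(χᵍ)^k ∈ K · 𝔳_P^{k-1}` for every `k ≥ j + 1` (pad with `χᵍ ∈ 𝔳_P` when `g ≠ 0`).
[folklore; cite: CoxLittleSchenck2011, §1.1] -/
theorem single_pow_mem_mul_pow_of_nsmul_eq (K : Ideal (AddMonoidAlgebra κ ↥P)) (g v : ↥P) (hg0 : g ≠ 0)
    (hv : AddMonoidAlgebra.single v (1 : κ) ∈ K) {j : ℕ} (q : Fin j → ↥P) (hq : ∀ i, q i ≠ 0)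
    (h : (j + 1) • g = v + ∑ i, q i) (k : ℕ) (hk : j + 1 ≤ k) :
    AddMonoidAlgebra.single g (1 : κ) ^ k ∈ K * 𝕍[κ, P] ^ (k - 1) := by
  -- `(χᵍ)^{j+1} = χᵛ · ∏ χ^{qᵢ}`
  have h1 : AddMonoidAlgebra.single g (1 : κ) ^ (j + 1) =
      AddMonoidAlgebra.single v (1 : κ) * ∏ i, AddMonoidAlgebra.single (q i) (1 : κ) := by
    rw [AddMonoidAlgebra.single_pow, one_pow, h, AddMonoidAlgebra.prod_single, Finset.prod_const_one,
      AddMonoidAlgebra.single_mul_single, mul_one]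
  have h2 : AddMonoidAlgebra.single g (1 : κ) ^ (j + 1) ∈ K * 𝕍[κ, P] ^ j := by
    rw [h1]
    exact Ideal.mul_mem_mul hv (prod_single_mem_vertexIdeal_pow κ P q hq)
  -- pad
  obtain ⟨d, rfl⟩ := Nat.exists_eq_add_of_le hk
  have h3 : AddMonoidAlgebra.single g (1 : κ) ^ (j + 1 + d) ∈ K * 𝕍[κ, P] ^ j * 𝕍[κ, P] ^ d := by
    rw [pow_add]
    exact Ideal.mul_mem_mul h2 (Ideal.pow_mem_pow (single_mem_vertexIdeal κ P g hg0) d)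
  have h4 : K * 𝕍[κ, P] ^ j * 𝕍[κ, P] ^ d = K * 𝕍[κ, P] ^ (j + 1 + d - 1) := by
    rw [mul_assoc, ← pow_add]
    congr 2
    omega
  rw [← h4]
  exact h3

/-- ★★ **THE REDUCTION SLOT FROM EXPONENT ARITHMETIC.** `xv : Fin N → κ[P]` monomial generators of `𝔳_P` (`xv i = χ^{gᵢ}`, `gᵢ ≠ 0`,
`𝔳_P = (xv)`), `K` an ideal containing `χ^{vᵢ}` for the chosen `vᵢ`, and for every `i` an identity `(jᵢ+1) • gᵢ = vᵢ + Σ q` with non-zero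
`q`'s and `jᵢ + 1 ≤ k`: then `𝔳_P^{N(k-1)+1} ⊆ K · 𝔳_P^{N(k-1)}`. With `K = (y)` this is `hred` of the certificate (`b = 0`).
[folklore; cite: HunekeSwanson2006, Def. 1.2.1] -/
theorem vertexIdeal_pow_le_of_nsmul_eq {N : ℕ} (xv : Fin N → AddMonoidAlgebra κ ↥P) (g : Fin N → ↥P) (hg0 : ∀ i, g i ≠ 0)
    (hxv : ∀ i, xv i = AddMonoidAlgebra.single (g i) 1) (hV : 𝕍[κ, P] = Ideal.span (Set.range xv))
    (K : Ideal (AddMonoidAlgebra κ ↥P)) (v : Fin N → ↥P) (hv : ∀ i, AddMonoidAlgebra.single (v i) (1 : κ) ∈ K)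
    (k : ℕ) (hk : 1 ≤ k) (j : Fin N → ℕ) (hj : ∀ i, j i + 1 ≤ k) (q : ∀ i, Fin (j i) → ↥P) (hq : ∀ i l, q i l ≠ 0)
    (h : ∀ i, (j i + 1) • g i = v i + ∑ l, q i l) :
    𝕍[κ, P] ^ (N * (k - 1) + 1) ≤ K * 𝕍[κ, P] ^ (N * (k - 1)) := by
  refine ReductionOfPowers.pow_le_mul_pow_of_forall_pow_mem' hk xv (𝕍[κ, P]) K hV fun i => ?_
  rw [hxv i]
  exact single_pow_mem_mul_pow_of_nsmul_eq κ P K (g i) (v i) (hg0 i) (hv i) (q i) (hq i) (h i) k (hj i)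

end Summit.ResolutionOfSingularities.ResolutionOfSingularities.Theorems.FRationalResolution.MonoidAlgebraModel

end
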